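import Summits.HodgeConjecture.HodgeCM.PerL34.CharSeparation_1

/-! PORT of `HodgeCM/PerL34/CharSeparation.lean` (HodgeCMPerL run 81) — part 2: continuation of `Summits.HodgeConjecture.HodgeCM.PerL34.CharSeparation_1` (split at a top-level declaration boundary by port_pkg.py; scope re-opened below; declarations unchanged). -/

-- port_pkg: scope re-opened for this part (file-level context, then the namespace/section stack open at the cut)
set_option autoImplicit false
noncomputable section
namespace HodgeCM
namespace PerL34
namespace CharSeparation
open MeasureTheory Topology ComplexConjugate Filter
open scoped InnerProductSpace ENNReal
/-! ## 5. Orthogonal projections commute with operators preserving the splitting -/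

section Proj

variable {E : Type*} [NormedAddCommGroup E] [InnerProductSpace ℂ E]

/-- (Ported verbatim from the HodgeCMPerL package; no docstring in the source.) -/
theorem starProjection_comm (U : Submodule ℂ E) [U.HasOrthogonalProjection] (A : E →L[ℂ] E)
    (hU : ∀ x ∈ U, A x ∈ U) (hU' : ∀ x ∈ Uᗮ, A x ∈ Uᗮ) (x : E) :
    U.starProjection (A x) = A (U.starProjection x) := by
  have hx : A x = A (U.starProjection x) + A (x - U.starProjection x) := by
    rw [← map_add, add_sub_cancel]
  have h1 : U.starProjection x ∈ U := by
    rw [Submodule.starProjection_apply]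
    exact Submodule.coe_mem _
  have h2 : x - U.starProjection x ∈ Uᗮ := U.sub_starProjection_mem_orthogonal x
  rw [hx, map_add, Submodule.starProjection_eq_self_iff.mpr (hU _ h1),
    (Submodule.starProjection_apply_eq_zero_iff (K := U)).mpr (hU' _ h2), add_zero]

end Proj

/-! ## 6. The main argument -/

section Main

variable {G : Type*} [CommGroup G] [TopologicalSpace G] [IsTopologicalGroup G] [CompactSpace G] [T2Space G]
  [MeasurableSpace G] [BorelSpace G] (μ : Measure G) [μ.IsMulLeftInvariant] [IsFiniteMeasure μ]
  [μ.IsOpenPosMeasure] [μ.Regular]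

/-- **Core.** If every continuous unitary character of `G` is trivial at `a`, then `τ_a` is the identity
of `L²(μ)` (i.e. its fixed space is everything). -/
theorem W_eq_top (a : G) (ha : ∀ χ : ContinuousMonoidHom G Circle, χ a = 1) : W μ a = ⊤ := by
  haveI : CompleteSpace (W μ a) := (isClosed_W μ a).completeSpace_coe
  rw [← Submodule.orthogonal_eq_bot_iff]
  by_contra hne
  obtain ⟨v, hvU, hv0⟩ := (Submodule.ne_bot_iff _).mp hne
  -- a convolution kernel acting non-trivially on `v` (approximate identity)
  obtain ⟨k, hk⟩ : ∃ k : C(G, ℂ), T μ k v ≠ 0 := by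
    by_contra h
    push Not at h
    exact hv0 (eq_zero_of_forall_T_eq_zero μ v h)
  set U : Submodule ℂ (Lp ℂ 2 μ) := (W μ a)ᗮ with hU
  -- invariance of `W` and `U = Wᗮ` under all translations (commutativity of `G`, unitarity)
  have hWτ : ∀ b, ∀ x ∈ W μ a, τ μ b x ∈ W μ a := by
    intro b x hx
    rw [mem_W] at hx ⊢
    rw [← τ_comm, hx]
  have hUτ : ∀ b, ∀ x ∈ U, τ μ b x ∈ U := by
    intro b x hx
    rw [hU, Submodule.mem_orthogonal] at hx ⊢
    intro u hu
    rw [← inner_τ_τ μ b⁻¹, τ_inv_τ]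
    exact hx _ (hWτ b⁻¹ u hu)
  let P : Lp ℂ 2 μ →L[ℂ] Lp ℂ 2 μ := U.starProjection
  have hPτ : ∀ b x, P (τ μ b x) = τ μ b (P x) := by
    intro b x
    refine starProjection_comm U (τ μ b) (hUτ b) ?_ x
    rw [hU, Submodule.orthogonal_orthogonal]
    exact hWτ b
  -- the compact positive operator `S = (T_k P)* (T_k P)`; it commutes with translations
  let A : Lp ℂ 2 μ →L[ℂ] Lp ℂ 2 μ := T μ k ∘L P
  let S : Lp ℂ 2 μ →L[ℂ] Lp ℂ 2 μ := ContinuousLinearMap.adjoint A ∘L A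
  have hAτ : ∀ b x, A (τ μ b x) = τ μ b (A x) := by
    intro b x
    change T μ k (P (τ μ b x)) = τ μ b (T μ k (P x))
    rw [hPτ, τ_T]
  have hSτ : ∀ b x, S (τ μ b x) = τ μ b (S x) := by
    intro b x
    change ContinuousLinearMap.adjoint A (A (τ μ b x)) = τ μ b (ContinuousLinearMap.adjoint A (A x))
    rw [hAτ, adjoint_τ_comm μ A hAτ]
  have hSc : IsCompactOperator S :=
    ((isCompactOperator_T μ k).comp_clm P).clm_comp (ContinuousLinearMap.adjoint A)
  have hSsa : IsSelfAdjoint S := (ContinuousLinearMap.isPositive_adjoint_comp_self A).isSelfAdjoint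
  have hSsym : (S : Lp ℂ 2 μ →ₗ[ℂ] Lp ℂ 2 μ).IsSymmetric := hSsa.isSymmetric
  -- `S ≠ 0` since `⟪S v, v⟫ = ‖T_k v‖² ≠ 0`
  have hPv : P v = v := Submodule.starProjection_eq_self_iff.mpr hvU
  have hAv : A v = T μ k v := by
    change T μ k (P v) = T μ k v
    rw [hPv]
  have hSv : S ≠ 0 := by
    intro hS
    have h1 : ‖A v‖ ^ 2 = RCLike.re ⟪S v, v⟫_ℂ := ContinuousLinearMap.apply_norm_sq_eq_inner_adjoint_left A v
    rw [hS, zero_apply, inner_zero_left, map_zero, sq_eq_zero_iff, norm_eq_zero,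
      hAv] at h1
    exact hk h1
  -- a non-zero eigenvalue of `S`, with finite-dimensional eigenspace `E ⊆ U`, invariant under translations
  obtain ⟨c, hc, hc0⟩ : ∃ c, Module.End.HasEigenvalue (S : Module.End ℂ (Lp ℂ 2 μ)) c ∧ c ≠ 0 := by
    by_contra h
    push Not at h
    exact hSv ((ContinuousLinearMap.eq_zero_of_forall_hasEigenvalue_eq_zero hSc hSsym).mp h)
  set E : Submodule ℂ (Lp ℂ 2 μ) := Module.End.eigenspace (S : Module.End ℂ (Lp ℂ 2 μ)) c with hEdef
  haveI : FiniteDimensional ℂ E := ContinuousLinearMap.finite_dimensional_eigenspace hSc c hc0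
  have hE0 : E ≠ ⊥ := Module.End.hasEigenvalue_iff.mp hc
  have hEτ : ∀ b, ∀ x ∈ E, τ μ b x ∈ E := by
    intro b x hx
    rw [hEdef, Module.End.mem_eigenspace_iff] at hx ⊢
    change S (τ μ b x) = c • τ μ b x
    rw [hSτ, show S x = c • x from hx, map_smul]
  have hEU : E ≤ U := by
    intro x hx
    rw [hEdef, Module.End.mem_eigenspace_iff] at hx
    have hSx : S x ∈ U := by
      change ContinuousLinearMap.adjoint (T μ k ∘L P) ((T μ k ∘L P) x) ∈ U
      rw [ContinuousLinearMap.adjoint_comp, (isSelfAdjoint_starProjection U).adjoint_eq,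
        ContinuousLinearMap.comp_apply, Submodule.starProjection_apply]
      exact Submodule.coe_mem _
    have hx' : x = c⁻¹ • S x := by
      rw [show S x = c • x from hx, smul_smul, inv_mul_cancel₀ hc0, one_smul]
    rw [hx']
    exact U.smul_mem _ hSx
  -- Schur: a common eigenline `F ⊆ E` of all translations; its eigenvalue function is a character
  obtain ⟨F, hFE, hF0, -, hFc⟩ := exists_common_eigenspace (fun b : G => (τ μ b).toLinearMap)
    (fun b b' x => τ_comm μ b b' x) E hE0 hEτ
  choose cχ hcχ using hFc
  obtain ⟨x₀, hx₀F, hx₀⟩ := (Submodule.ne_bot_iff F).mp hF0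
  have hx₀c : ∀ b, τ μ b x₀ = cχ b • x₀ := fun b => hcχ b x₀ hx₀F
  have hnorm : ∀ b, ‖cχ b‖ = 1 := by
    intro b
    have h := norm_τ μ b x₀
    rw [hx₀c, norm_smul] at h
    exact (mul_eq_right₀ (norm_ne_zero_iff.mpr hx₀)).mp h
  have hmul : ∀ b b', cχ (b * b') = cχ b * cχ b' := by
    intro b b'
    have h := hx₀c (b * b')
    rw [τ_mul, hx₀c b', map_smul, hx₀c b, smul_smul, mul_comm] at h
    exact ((smul_left_inj hx₀).mp h).symm
  have hone : cχ 1 = 1 := by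
    have h := hx₀c 1
    rw [τ_one] at h
    have h' : (1 : ℂ) • x₀ = cχ 1 • x₀ := by rwa [one_smul]
    exact ((smul_left_inj hx₀).mp h').symm
  have hcont : Continuous cχ := by
    have h1 : Continuous fun b => ⟪x₀, τ μ b x₀⟫_ℂ := continuous_const.inner (continuous_τ_apply μ x₀)
    have h2 : cχ = fun b => ⟪x₀, τ μ b x₀⟫_ℂ * (⟪x₀, x₀⟫_ℂ)⁻¹ := by
      funext b
      rw [hx₀c, inner_smul_right, mul_inv_cancel_right₀ (inner_self_ne_zero.mpr hx₀)]
    rw [h2]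
    exact h1.mul continuous_const
  let χ : ContinuousMonoidHom G Circle :=
    { toFun := fun b => ⟨cχ b, mem_sphere_zero_iff_norm.mpr (hnorm b)⟩
      map_one' := Circle.ext (by simp [hone])
      map_mul' := fun b b' => Circle.ext (by simp [hmul])
      continuous_toFun := hcont.subtype_mk _ }
  have hχa : cχ a = 1 := congrArg (fun z : Circle => (z : ℂ)) (ha χ)
  -- `x₀` is fixed by `τ_a`, yet orthogonal to the fixed space: contradiction
  have hx₀W : x₀ ∈ W μ a := by
    rw [mem_W, hx₀c, hχa, one_smul]
  have hx₀U : x₀ ∈ U := hEU (hFE hx₀F)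
  have hbot : x₀ ∈ W μ a ⊓ (W μ a)ᗮ := ⟨hx₀W, hx₀U⟩
  rw [Submodule.inf_orthogonal_eq_bot, Submodule.mem_bot] at hbot
  exact hx₀ hbot

include μ in
/-- Consequence: every continuous function is invariant under `a`, in particular `f a⁻¹ = f 1`. -/
theorem apply_inv_eq_of_forall_char (a : G) (ha : ∀ χ : ContinuousMonoidHom G Circle, χ a = 1)
    (f : C(G, ℂ)) : f a⁻¹ = f 1 := by
  have hW := W_eq_top μ a ha
  have hf : ContinuousMap.toLp (E := ℂ) 2 μ ℂ f ∈ W μ a := by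
    rw [hW]
    exact Submodule.mem_top
  rw [mem_W, τ_toLp] at hf
  have hf' := ContinuousMap.toLp_injective (E := ℂ) (p := 2) (𝕜 := ℂ) μ hf
  have := congrArg (fun g : C(G, ℂ) => g 1) hf'
  simpa using this

end Main

/-! ## 7. The theorem: characters separate points of a compact abelian group -/

section Final

variable {G : Type*} [CommGroup G] [TopologicalSpace G] [IsTopologicalGroup G] [CompactSpace G] [T2Space G]

/-- For `a ≠ 1` in a compact Hausdorff abelian group there is a continuous unitary character with
`χ a ≠ 1`. -/
theorem exists_char_ne_one {a : G} (ha : a ≠ 1) : ∃ χ : ContinuousMonoidHom G Circle, χ a ≠ 1 := by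
  by_contra h
  push Not at h
  borelize G
  let μ : Measure G := MeasureTheory.Measure.haar
  obtain ⟨f, hf0, hf1, -⟩ := exists_continuous_zero_one_of_isClosed (isClosed_singleton (x := a⁻¹))
    (isClosed_singleton (x := (1 : G))) (by
      rw [Set.disjoint_singleton]
      exact inv_ne_one.mpr ha)
  let fC : C(G, ℂ) := ⟨fun x => (f x : ℂ), by fun_prop⟩
  have h1 : fC a⁻¹ = fC 1 := apply_inv_eq_of_forall_char (μ := μ) a h fC
  have h2 : f a⁻¹ = 0 := hf0 rfl
  have h3 : f 1 = 1 := hf1 rfl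
  have h4 : (f a⁻¹ : ℂ) = f 1 := h1
  rw [h2, h3] at h4
  norm_num at h4

/-- **Characters separate points** — exactly the shape of pv11's `SupplyElementary.CharSeparating G` and of the
hypothesis `hsep` of `CharCompleteness.eq_zero_of_forall_character_orthogonal`. -/
theorem charSeparating (g h : G) (hgh : g ≠ h) : ∃ χ : PontryaginDual G, χ g ≠ χ h := by
  obtain ⟨χ, hχ⟩ := exists_char_ne_one (G := G) (a := g * h⁻¹) (by rwa [Ne, mul_inv_eq_one])
  refine ⟨χ, fun heq => hχ ?_⟩
  have heq' : χ g = χ h := heq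
  rw [map_mul, map_inv, heq', mul_inv_cancel]

end Final

end CharSeparation
end PerL34
end HodgeCM

end
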